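import Summits.BirchSwinnertonDyer.BirchSwinnertonDyer.Theorems.Rank2ObservatoryThreeIsoPrimes
import HarnessLib

/-!
# BirchSwinnertonDyer — rank ≥ 2 observatory: KERNEL-3ISO, inert primes `q ≡ 2 (mod 3)` of `ℤ[ζ₃]`

HONEST FRAMING: per-curve certified theorems and census instruments; no claim on BSD in rank ≥ 2.

The Ê-side of the `3`-isogeny descent (file `Rank2ObservatoryThreeIsoPrimes`) needs, for every rational
prime `q` dividing `81 s - 12 m³` with `q ≡ 2 (mod 3)`, that `q` stays prime in `𝓞 K`, `K = ℚ(ζ₃)`.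
`prime_intCast_of_anisotropic` reduces this to the anisotropy of the norm form `a² - ab + b²` over `𝔽_q`,
which the per-row files so far discharged by `decide` (feasible only for small `q`). Here the anisotropy is
proved once and for all: a non-trivial zero gives `z = -a/b` with `z² + z + 1 = 0`, hence `z³ = 1`, `z ≠ 1`
(as `3 ≠ 0` in `𝔽_q`), while `z^{q-1} = 1` and `gcd(3, q - 1) = 1` force `z = 1`.

Results (namespace `…Rank2Observatory.ThreeIso`, `(hζ : IsPrimitiveRoot ζ 3)`, `η = hζ.toInteger`):
* `anisotropic_of_mod_three_eq_two` — `q` prime, `q % 3 = 2` ⇒ `a² - ab + b² = 0 → a = b = 0` in `ZMod q`;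
* `prime_inert` — `Prime ((q : ℤ) : 𝓞 K)`; `prime_inert_coords` — the same element written in the
  integer coordinates `q + 0·η` used by the per-row prime families.
No definitions; no `native_decide`; axioms standard.
References: H. Cohen, *Number Theory I* (GTM 239, 2007), §8.4 (descent over `ℚ(ζ₃)`);
K. Ireland, M. Rosen, *A Classical Introduction to Modern Number Theory*, Prop. 9.1.4 (splitting of rational
primes in `ℤ[ω]`). [folklore]
-/

set_option linter.dupNamespace false

namespace Summit.BirchSwinnertonDyer.BirchSwinnertonDyer.Rank2Observatory.ThreeIso

open NumberField

/-- **Anisotropy of `a² - ab + b²` over `𝔽_q` for `q ≡ 2 (mod 3)`**: the form has no non-trivial zero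
(equivalently `-3` is a non-residue, equivalently `𝔽_q` has no primitive cube root of unity).
[cite: IrelandRosen1990, Prop. 9.1.4] [folklore] -/
theorem anisotropic_of_mod_three_eq_two {q : ℕ} (hq : q.Prime) (h3 : q % 3 = 2) :
    ∀ a b : ZMod q, a ^ 2 - a * b + b ^ 2 = 0 → a = 0 ∧ b = 0 := by
  haveI := Fact.mk hq
  intro a b hab
  by_cases hb : b = 0
  · subst hb
    have ha2 : a ^ 2 = 0 := by simpa using hab
    exact ⟨pow_eq_zero_iff two_ne_zero |>.mp ha2, rfl⟩
  · exfalso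
    -- `z = -a/b` is a root of `z² + z + 1`
    set z : ZMod q := -a * b⁻¹ with hz
    have hz2 : z ^ 2 + z + 1 = 0 := by
      have hzb : z * b = -a := by
        rw [hz, mul_assoc, inv_mul_cancel₀ hb, mul_one]
      have hb2 : b ^ 2 ≠ 0 := pow_ne_zero 2 hb
      have key : (z ^ 2 + z + 1) * b ^ 2 = a ^ 2 - a * b + b ^ 2 := by
        linear_combination (z * b - a + b) * hzb
      rw [hab] at key
      exact (mul_eq_zero.mp key).resolve_right hb2
    -- hence `z³ = 1`, `z ≠ 0`, `z ≠ 1`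
    have hz3 : z ^ 3 = 1 := by linear_combination (z - 1) * hz2
    have hz0 : z ≠ 0 := by
      intro h
      rw [h] at hz2
      norm_num at hz2
    have hz1 : z ≠ 1 := by
      intro h
      rw [h] at hz2
      have h30 : ((3 : ℕ) : ZMod q) = 0 := by
        rw [Nat.cast_ofNat]
        linear_combination hz2
      have hq3 : q ∣ 3 := (ZMod.natCast_eq_zero_iff 3 q).mp h30
      have : q = 3 := (Nat.prime_dvd_prime_iff_eq hq Nat.prime_three).mp hq3
      omega
    -- Fermat: `z^(q-1) = 1`; with `gcd(3, q-1) = 1` this forces `z = 1`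
    have hF : z ^ (q - 1) = 1 := ZMod.pow_card_sub_one_eq_one hz0
    have hg : Nat.gcd 3 (q - 1) = 1 := by
      have h1 : (q - 1) % 3 = 1 := by
        have := hq.two_le
        omega
      rw [Nat.gcd_rec, h1, Nat.gcd_one_left]
    have h1 : z ^ Nat.gcd 3 (q - 1) = 1 := pow_gcd_eq_one.mpr ⟨hz3, hF⟩
    rw [hg, pow_one] at h1
    exact hz1 h1

variable {K : Type*} [Field K] [NumberField K] [IsCyclotomicExtension {3} ℚ K] {ζ : K}

/-- **Inert primes**: a rational prime `q ≡ 2 (mod 3)` is prime in `𝓞 K`, `K = ℚ(ζ₃)`.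
[cite: IrelandRosen1990, Prop. 9.1.4] [cite: Cohen2007NumberTheoryI, §8.4] [folklore] -/
theorem prime_inert (hζ : IsPrimitiveRoot ζ 3) {q : ℕ} (hq : q.Prime) (h3 : q % 3 = 2) :
    Prime ((q : ℤ) : 𝓞 K) :=
  prime_intCast_of_anisotropic hζ hq (anisotropic_of_mod_three_eq_two hq h3)

/-- Inert primes in the integer coordinates `q + 0·η` of the per-row prime families.
[cite: IrelandRosen1990, Prop. 9.1.4] [folklore] -/
theorem prime_inert_coords (hζ : IsPrimitiveRoot ζ 3) {q : ℕ} (hq : q.Prime) (h3 : q % 3 = 2) :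
    Prime (((q : ℤ) : 𝓞 K) + (0 : ℤ) * hζ.toInteger) := by
  have : ((q : ℤ) : 𝓞 K) + (0 : ℤ) * hζ.toInteger = ((q : ℤ) : 𝓞 K) := by push_cast; ring
  rw [this]
  exact prime_inert hζ hq h3

end Summit.BirchSwinnertonDyer.BirchSwinnertonDyer.Rank2Observatory.ThreeIso
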